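import Literature.MathematicalPhysics.QuantumFieldTheory.Balaban1983to89.B8Ineq132
import Summits.QuantumFields.BalabanUV.T4Continuum.Support.MinimalActionRate

/-!
# T⁴ programme, node NE3 — dictionary item S3-D6-neg (typer v1.22 ρ36 (iv); GAPS G-ne3leaf09g2-1): THE PLAQUETTE-ONLY
# SMALL-FIELD BALL `sfClass ε′` DOES NOT EMBED IN B8's REGULAR SPACE `𝔄_k` = B11's `𝔘_k({T_η}, ε₀)` (the first factor of
# class (6)) — a kernel counterexample, for every `ε′ > 0`, every `ε₀`, at every fine enough level

NE3 formalisation swarm, LEAF PROVER 09 gen 2 (unit `b2b-balaban-t4-ne3-formalise-leaf-09`), sub-row S3-D6-neg (CLAIM journal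
2026-08-20T10:5xZ).  CONTEXT.  The class-agnostic END of route (A) (`MinimalActionClassAgnostic.actionRate_of_exists_approx_class`
(50S), `MinimalActionThm1Type.actionRate_thm1Type_class` (48S-b)) carries `hsub : ∀ j, sfClass d L N ε j ⊆ 𝒞 j`; (50S)'s
docstring proposed to reach B11's class (6) read exactly through an inclusion `(6)_{ε₀} ⊇ sfClass ε′`.  Three concurrent
readings of B8 p. 76 (1.1)–(1.2) and p. 77 (1.7)–(1.9) (leaf-04 g2 journal l.10647, leaf-09 g2 GAPS G-ne3leaf09g2-1, leaf-05 g3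
l.10705) agree that this inclusion is FALSE levelwise-uniformly: the co-derivative (1.1) carries `η⁻¹ = L^k`, so (1.9) at the
binding level `j = k`, `η = L^{−k}` (B11 (5)), bounds the lattice Yang–Mills CURRENT one order beyond the plaquettes.  THIS
FILE is the kernel witness, in the TREE's vocabulary of the printed definitions (`B8Ineq132.plaqF`, `covDeriv` — with the
printed `η⁻¹` —, `covDiv` = (1.2), `CondAt` = (1.7)+(1.9), `InAk` = `𝔄_k({Ω_j}, α₀)`, all cite-tagged there; nothing re-typed):
* §1 scalar bookkeeping for centre-valued configurations `scalarCfg f` (`T4AveragingDeficitWallBoundary`, BY NAME): unitarity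
  for imaginary exponents, periodicity, the plaquette field `plaqF (scalarCfg f) κ ν x = e^{f(x,κ)+f(x+e_κ,ν)−f(x+e_ν,κ)−f(x,ν)}·1`,
  `‖e^{ir}·1 − 1‖ ≤ |r|`, `‖e^{iτ}·1 − e^{−iτ}·1‖ = 2|sin τ|`;
* §2 **`exists_mem_sfClass_not_condAt`**: for `d ≥ 2`, `L ≥ 2`, `N ≥ 1`, every `ε′ > 0` and every `ε₀` there are `k` and
  `U ∈ sfClass d L N ε′ k` with `¬ CondAt L ((L^k)⁻¹) ε₀ k univ U`; **`exists_mem_sfClass_not_inAk`**: hence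
  `¬ InAk L k ((L^k)⁻¹) ε₀ (fun _ ↦ univ) U` — `U ∉ 𝔘_k({T_η}, ε₀)`; **`not_sfClass_subset_condAt`**: so NO radius `ε′ > 0` gives
  `∀ k, sfClass d L N ε′ k ⊆ {U | CondAt L ((L^k)⁻¹) ε₀ k univ U}`.
  WITNESS (abelian): `U = scalarCfg f`, `f(x, e₁) = i·θ(x₀)`, `f(x, e_μ) = 0` (`μ ≠ e₁`), `θ(m) = τ·1_{m ≡ 1 (mod N·L^k)}`,
  `τ = ε′/(2(L^k)²)`, `L^k ≥ max(ε′, 2ε₀/ε′)`: every plaquette variable is `e^{±iτ}·1` or `1` (within `τ ≤ ε′(L^k)^{−2}` of `1`),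
  while `(D^{η*}_U∂U)(⟨e₀, e₀+e₁⟩) = η⁻¹(e^{iτ} − e^{−iτ})·1` has norm `L^k·2 sin τ > L^k·τ ≥ ε₀(L^k)^{−2}` = the threshold of
  (1.9) at `j = k`, `η = L^{−k}` (`(L^kη)^{−1} = 1`).
CONSEQUENCE (bookkeeping, no landed theorem affected): `hsub` of (50S)/A19 cannot be instantiated at 𝒞 = class (6); the
class-(6) reading of route (A) goes through MEMBERSHIP of the sandwich's two competitors instead (S3-D6 (α) `RegularSup ⊆ (6)`,
leaf-04 g2; S3-D7 the current under averaging, B8 Prop. 3 TYPE) — typer ρ36.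

HONEST FRAMING.  An explicit counterexample to ONE proposed dictionary bridge; no minimiser, no printed sentence as hypothesis,
no `def`, no `sorry`; axioms ⊆ {propext, Classical.choice, Quot.sound}.  **NE3 is NOT proved**; route (A) stays CONDITIONAL on
(H∃) [B11 Thm 1 TYPE]; spine PROVED 0/9; `BetaPertH`, (B), G-an2-4 absent; finite T⁴ rung (B)+1 — NOT infinite volume, NOT a mass
gap, NOT the Clay problem.  HONEST DEPENDENCY (cell page 1): continuum YM on T⁴ ⇐ BetaPertH ∧ nine spine estimates (0/9 proved);
BetaPertH ⇐ (D1) ∧ (D4) ∧ CAP+tail; G-an2-4 gates asym, D1 and NE2/3/4.  PLACEMENT (human rule 2026-08-19): under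
`Summits/QuantumFields/BalabanUV/`; imports `Literature.….B8Ineq132` + `Support.MinimalActionRate` only; restates nothing.
Sources re-read AS IMAGES: B8 CMP 99 pp. 76–77 `b2b-balaban-ref1/pages/1985-cmp99-regular-spaces-gauge-fixing/…-p002/p003-x2.png`,
B11 CMP 102 p. 278 `…/1985-cmp102-variational-background/…-p002-x2.png`.
-/

set_option autoImplicit false

open scoped BigOperators Matrix Matrix.Norms.L2Operator
open NormedSpace Finset

namespace Summit.QuantumFields.BalabanUV.T4Continuum.MinimalActionClassSixNeg

open Literature.MathematicalPhysics.QuantumFieldTheory.Balaban1983to89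
open B7Prop1Explicit B7Prop2Explicit B7Prop1Local MatrixLog UnitaryModel
open T4AveragingDeficitWall hiding Site Plane Plaq Bond
open T4AveragingDeficitWallBoundary (IsPeriodicCfg scalarCfg val_hol_scalarCfg smul_one_mem_unitary)
open B7Eq78Linearization (conjR conjR_one)
open FederbushMean (cexp_smul_one norm_smul_one_eq norm_smul_one_sub_one)
open B8Ineq132 (plaqF covDeriv covDiv CondAt InAk one_conjR)
open MinimalActionRate (sfClass)

noncomputable section

variable {d : ℕ} {n : Type*} [Fintype n] [DecidableEq n]

/-! ## §1 Centre-valued bookkeeping -/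

/-- A centre-valued configuration with PURELY IMAGINARY exponents `i·g(x,μ)` is `U(N)`-valued. [folklore] -/
theorem isUnitaryCfg_scalarCfg_imag (g : B7Prop1Explicit.Site d → Fin d → ℝ) :
    IsUnitaryCfg (scalarCfg (n := n) (fun x μ => ((g x μ : ℝ) : ℂ) * Complex.I)) := by
  intro x μ
  rw [mem_unitaryUnits, scalarCfg, val_expUnit, ← cexp_smul_one]
  exact smul_one_mem_unitary (Complex.norm_exp_ofReal_mul_I (g x μ))

/-- A centre-valued configuration with `P`-periodic exponents is `P`-periodic. [folklore] -/
theorem isPeriodicCfg_scalarCfg {f : B7Prop1Explicit.Site d → Fin d → ℂ} {P : ℤ}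
    (hf : ∀ (x : B7Prop1Explicit.Site d) (κ μ : Fin d), f (x + P • e κ) μ = f x μ) :
    IsPeriodicCfg (scalarCfg (n := n) f) P := by
  intro x κ μ
  simp only [scalarCfg, hf]

/-- The plaquette field of a centre-valued configuration: `F_{κν}(x) = e^{f(x,κ) + f(x+e_κ,ν) − f(x+e_ν,κ) − f(x,ν)}·1`. [folklore] -/
theorem plaqF_scalarCfg (f : B7Prop1Explicit.Site d → Fin d → ℂ) (κ ν : Fin d) (x : B7Prop1Explicit.Site d) :
    plaqF (scalarCfg (n := n) f) κ ν x
      = Complex.exp (f x κ + f (x + e κ) ν - f (x + e ν) κ - f x ν) • (1 : Matrix n n ℂ) := by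
  rw [plaqF, val_hol_scalarCfg, asum_plaqWord, cexp_smul_one]

/-- `‖e^{ir}·1 − 1‖ ≤ |r|`. [folklore] -/
theorem norm_cexp_mul_I_smul_one_sub_one_le [Nonempty n] (r : ℝ) :
    ‖Complex.exp ((r : ℂ) * Complex.I) • (1 : Matrix n n ℂ) - 1‖ ≤ |r| := by
  rw [norm_smul_one_sub_one, mul_comm]
  exact (Real.norm_exp_I_mul_ofReal_sub_one_le (x := r)).trans (le_of_eq (Real.norm_eq_abs r))

/-- `‖e^{iτ}·1 − e^{−iτ}·1‖ = 2|sin τ|`. [folklore] -/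
theorem norm_cexp_sub_cexp_neg [Nonempty n] (τ : ℝ) :
    ‖Complex.exp ((τ : ℂ) * Complex.I) • (1 : Matrix n n ℂ) - Complex.exp (((-τ : ℝ) : ℂ) * Complex.I) • (1 : Matrix n n ℂ)‖
      = 2 * |Real.sin τ| := by
  rw [← sub_smul, norm_smul_one_eq, Complex.exp_mul_I, Complex.exp_mul_I, Complex.ofReal_neg, Complex.cos_neg,
    Complex.sin_neg, ← Complex.ofReal_sin, ← Complex.ofReal_cos]
  rw [show ((Real.cos τ : ℝ) : ℂ) + ((Real.sin τ : ℝ) : ℂ) * Complex.I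
      - (((Real.cos τ : ℝ) : ℂ) + -((Real.sin τ : ℝ) : ℂ) * Complex.I) = ((2 * Real.sin τ : ℝ) : ℂ) * Complex.I by
    push_cast; ring]
  rw [norm_mul, Complex.norm_I, mul_one, Complex.norm_real, Real.norm_eq_abs, abs_mul, abs_of_pos two_pos]

/-! ## §2 The witness -/

/-- **S3-D6-neg — THE PLAQUETTE-ONLY BALL IS NOT IN THE REGULAR SPACE**: for `d ≥ 2`, `L ≥ 2`, `N ≥ 1`, every `ε′ > 0` and
every `ε₀` there are a level `k` and `U ∈ sfClass d L N ε′ k` violating (1.7)+(1.9) at level `k` on the whole torus with B11's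
`η = L^{−k}`: `¬ CondAt L ((L^k)⁻¹) ε₀ k univ U` — the CURRENT clause (1.9) fails at the bond `⟨e₀, e₀ + e₁⟩` (module docstring
for the witness). [folklore] -/
theorem exists_mem_sfClass_not_condAt [Nonempty n] (hd : 2 ≤ d) {L : ℕ} (hL : 2 ≤ L) {N : ℕ} (hN : 1 ≤ N) {ε : ℝ}
    (hε : 0 < ε) (ε₀ : ℝ) :
    ∃ (k : ℕ) (U : B7Prop1Explicit.Site d → Fin d → (Matrix n n ℂ)ˣ),
      U ∈ sfClass (d := d) (n := n) L N ε k ∧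
        ¬ CondAt L (((L : ℝ) ^ k)⁻¹) ε₀ k (Set.univ : Set (B7Prop1Explicit.Site d)) U := by
  -- the two directions
  set μ₁ : Fin d := ⟨0, by omega⟩ with hμ₁
  set μ₂ : Fin d := ⟨1, by omega⟩ with hμ₂
  have h12 : μ₁ ≠ μ₂ := by simp [hμ₁, hμ₂]
  have h12' : μ₁ < μ₂ := by rw [hμ₁, hμ₂, Fin.lt_def]; norm_num
  -- the level: `L^k ≥ max(ε, 2ε₀/ε)`, `k ≥ 1`
  have hL1 : (1 : ℝ) < L := by exact_mod_cast hL
  obtain ⟨k₀, hk₀⟩ := pow_unbounded_of_one_lt (max ε (2 * ε₀ / ε)) hL1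
  set k : ℕ := k₀ + 1 with hk
  set s : ℝ := (L : ℝ) ^ k with hsdef
  have hs0 : 0 < s := by positivity
  have hsk₀ : (L : ℝ) ^ k₀ ≤ s := by
    rw [hsdef, hk, pow_succ]; exact le_mul_of_one_le_right (by positivity) hL1.le
  have hsε : ε ≤ s := ((le_max_left _ _).trans hk₀.le).trans hsk₀
  have hsα : 2 * ε₀ / ε ≤ s := ((le_max_right _ _).trans hk₀.le).trans hsk₀
  have hs1 : 1 ≤ s := by rw [hsdef]; exact one_le_pow₀ hL1.le
  -- the period
  set P : ℤ := ((N * L ^ k : ℕ) : ℤ) with hPdef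
  have hP2 : (2 : ℤ) ≤ P := by
    rw [hPdef]
    have : 2 ≤ N * L ^ k := by
      calc 2 ≤ 1 * 2 ^ 1 := by norm_num
        _ ≤ N * L ^ k := Nat.mul_le_mul hN (le_trans (Nat.pow_le_pow_left hL 1) (Nat.pow_le_pow_right (by omega) (by omega)))
    exact_mod_cast this
  -- the radius
  set τ : ℝ := ε / (2 * s ^ 2) with hτdef
  have hτ0 : 0 < τ := by positivity
  have hτε : τ ≤ ε / s ^ 2 := by
    rw [hτdef]; exact div_le_div_of_nonneg_left hε.le (by positivity) (by nlinarith)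
  have hτ1 : τ ≤ 1 := by
    rw [hτdef, div_le_one (by positivity)]; nlinarith
  have hτα : ε₀ / s ^ 3 ≤ τ := by
    rw [hτdef, div_le_div_iff₀ (by positivity) (by positivity)]
    have h1 : 2 * ε₀ ≤ ε * s := by
      have := (div_le_iff₀ hε).mp hsα; linarith
    nlinarith [pow_pos hs0 2]
  -- the exponents
  set θ : ℤ → ℝ := fun m => if m % P = 1 then τ else 0 with hθdef
  have hθ0 : ∀ m, 0 ≤ θ m := fun m => by simp only [hθdef]; split_ifs <;> linarith
  have hθτ : ∀ m, θ m ≤ τ := fun m => by simp only [hθdef]; split_ifs <;> linarith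
  have hθper : ∀ m : ℤ, θ (m + P) = θ m := fun m => by simp only [hθdef, Int.add_emod_right]
  have hθ_at0 : θ 0 = 0 := by
    simp only [hθdef, Int.zero_emod]; norm_num
  have hθ_at1 : θ 1 = τ := by
    simp only [hθdef, Int.emod_eq_of_lt (show (0 : ℤ) ≤ 1 by norm_num) (show (1 : ℤ) < P by omega), if_true]
  have hθ_at2 : θ 2 = 0 := by
    simp only [hθdef]
    rcases eq_or_lt_of_le hP2 with h | h
    · rw [← h]; norm_num
    · rw [Int.emod_eq_of_lt (by norm_num) h]; norm_num
  set g : B7Prop1Explicit.Site d → Fin d → ℝ := fun x μ => if μ = μ₂ then θ (x μ₁) else 0 with hgdef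
  set f : B7Prop1Explicit.Site d → Fin d → ℂ := fun x μ => ((g x μ : ℝ) : ℂ) * Complex.I with hfdef
  set U : B7Prop1Explicit.Site d → Fin d → (Matrix n n ℂ)ˣ := scalarCfg f with hUdef
  -- (a) unitary
  have hUu : IsUnitaryCfg U := isUnitaryCfg_scalarCfg_imag g
  -- values of `g`: in `[0, τ]`, `0` off the direction `μ₂`, `θ(x₀)` on it
  have hgb : ∀ (y : B7Prop1Explicit.Site d) (μ : Fin d), 0 ≤ g y μ ∧ g y μ ≤ τ := fun y μ => by
    simp only [hgdef]; split_ifs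
    · exact ⟨hθ0 _, hθτ _⟩
    · exact ⟨le_rfl, hτ0.le⟩
  have hgz : ∀ (y : B7Prop1Explicit.Site d) (μ : Fin d), μ ≠ μ₂ → g y μ = 0 := fun y μ hμ => by
    simp only [hgdef, hμ, if_false]
  have hg2 : ∀ (y : B7Prop1Explicit.Site d), g y μ₂ = θ (y μ₁) := fun y => by simp only [hgdef, if_true]
  -- (b) periodic
  have hUp : IsPeriodicCfg U P := by
    refine isPeriodicCfg_scalarCfg fun x κ μ => ?_
    simp only [hfdef]
    congr 2
    by_cases hμ : μ = μ₂
    · rw [hμ, hg2, hg2, Pi.add_apply, Pi.smul_apply, e_apply, smul_eq_mul]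
      split_ifs
      · rw [mul_one, hθper]
      · rw [mul_zero, add_zero]
    · rw [hgz _ _ hμ, hgz _ _ hμ]
  -- (c) the plaquette fields: `e^{ir}·1`, `|r| ≤ τ`
  have hplaq : ∀ (x : B7Prop1Explicit.Site d) (κ ν : Fin d), ∃ r : ℝ, |r| ≤ τ ∧
      plaqF U κ ν x = Complex.exp ((r : ℂ) * Complex.I) • (1 : Matrix n n ℂ) := by
    intro x κ ν
    refine ⟨g x κ + g (x + e κ) ν - g (x + e ν) κ - g x ν, ?_, ?_⟩
    · by_cases hκ : κ = μ₂
      · by_cases hν : ν = μ₂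
        · rw [hκ, hν, show g x μ₂ + g (x + e μ₂) μ₂ - g (x + e μ₂) μ₂ - g x μ₂ = 0 by ring, abs_zero]
          exact hτ0.le
        · rw [hgz _ _ hν, hgz _ _ hν, add_zero, sub_zero, abs_sub_le_iff]
          obtain ⟨h1, h2⟩ := hgb x κ; obtain ⟨h3, h4⟩ := hgb (x + e ν) κ
          constructor <;> linarith
      · rw [hgz _ _ hκ, hgz _ _ hκ, zero_add, sub_zero, abs_sub_le_iff]
        obtain ⟨h1, h2⟩ := hgb x ν; obtain ⟨h3, h4⟩ := hgb (x + e κ) ν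
        constructor <;> linarith
    · rw [hUdef, plaqF_scalarCfg]
      congr 1
      simp only [hfdef]; push_cast; ring
  -- (d) membership in `sfClass`
  have hUsf : U ∈ sfClass (d := d) (n := n) L N ε k := by
    refine ⟨hUu, hUp, fun x κ κ' _ => ?_⟩
    obtain ⟨r, hr, hhol⟩ := hplaq x κ κ'
    rw [← plaqF, hhol]
    exact ((norm_cexp_mul_I_smul_one_sub_one_le r).trans hr).trans hτε
  refine ⟨k, U, hUsf, fun hC => ?_⟩
  -- (e) the current clause of (1.9) at the bond `⟨e₀, e₀ + e₁⟩`
  obtain ⟨-, hcur⟩ := hC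
  have hlt := hcur (e μ₁) μ₂ (Or.inl (Set.mem_univ _))
  -- the index sets at `μ₂ = 1`: `Iio μ₂ = {μ₁}`
  have hS1 : Finset.Iio μ₂ = {μ₁} := by
    ext ν
    simp only [Finset.mem_Iio, Finset.mem_singleton, hμ₁, hμ₂, Fin.lt_def, Fin.ext_iff]
    omega
  -- the plaquette fields `F_{μ₂ν}`, `ν > μ₂`, are identically `1`
  have htriv : ∀ ν : Fin d, μ₂ < ν → ∀ z : B7Prop1Explicit.Site d, plaqF U μ₂ ν z = 1 := by
    intro ν hν z
    have hν2 : ν ≠ μ₂ := hν.ne'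
    have hν1 : ν ≠ μ₁ := fun h => by rw [h] at hν; exact lt_asymm h12' hν
    have hν1' : μ₁ ≠ ν := fun h => hν1 h.symm
    rw [hUdef, plaqF_scalarCfg]
    have e1 : (z + e ν) μ₁ = z μ₁ := by rw [Pi.add_apply, e_apply, if_neg hν1', add_zero]
    simp only [hfdef, hg2, hgz _ _ hν2, e1]
    push_cast
    rw [show ((θ (z μ₁) : ℝ) : ℂ) * Complex.I + 0 * Complex.I - (θ (z μ₁) : ℂ) * Complex.I - 0 * Complex.I = 0 by ring,
      Complex.exp_zero, one_smul]
  have hsum2 : ∑ ν ∈ Finset.Ioi μ₂, covDeriv (((L : ℝ) ^ k)⁻¹) U ν (plaqF U μ₂ ν) (e μ₁) = 0 := by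
    refine Finset.sum_eq_zero fun ν hν => ?_
    have hν : μ₂ < ν := Finset.mem_Ioi.mp hν
    simp only [covDeriv, htriv ν hν, conjR_one, sub_self, smul_zero]
  -- the bond below the base point carries `1`
  have hU0 : U (e μ₁ - e μ₁) μ₁ = 1 := by
    rw [hUdef, scalarCfg]
    simp only [hfdef, hgz _ _ h12]
    push_cast
    rw [zero_mul, zero_smul, T4AveragingDeficitWall.expUnit_zero]
  -- the two `(μ₁, μ₂)` plaquette fields at `0` and `e₀`
  have hF : ∀ z : B7Prop1Explicit.Site d, plaqF U μ₁ μ₂ z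
      = Complex.exp (((θ (z μ₁ + 1) - θ (z μ₁) : ℝ) : ℂ) * Complex.I) • (1 : Matrix n n ℂ) := by
    intro z
    rw [hUdef, plaqF_scalarCfg]
    have e1 : (z + e μ₁) μ₁ = z μ₁ + 1 := by rw [Pi.add_apply, e_apply, if_pos rfl]
    congr 1
    simp only [hfdef, hg2, hgz _ _ h12, e1]
    push_cast; ring
  have hcurEq : covDiv (((L : ℝ) ^ k)⁻¹) U μ₂ (e μ₁)
      = (((L : ℝ) ^ k)⁻¹)⁻¹ • (Complex.exp ((τ : ℂ) * Complex.I) • (1 : Matrix n n ℂ)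
        - Complex.exp (((-τ : ℝ) : ℂ) * Complex.I) • (1 : Matrix n n ℂ)) := by
    unfold covDiv
    rw [hsum2, sub_zero, hS1, Finset.sum_singleton, covDeriv, hU0, inv_one, one_conjR, hF, hF]
    have e0 : (e μ₁ - e μ₁ : B7Prop1Explicit.Site d) μ₁ = 0 := by rw [sub_self, Pi.zero_apply]
    have e1' : (e μ₁ : B7Prop1Explicit.Site d) μ₁ = 1 := by rw [e_apply, if_pos rfl]
    rw [e0, e1', show (0 : ℤ) + 1 = 1 by norm_num, show (1 : ℤ) + 1 = 2 by norm_num, hθ_at0, hθ_at1, hθ_at2,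
      sub_zero, zero_sub]
  -- size: `L^k · 2 sin τ > L^k · τ ≥ ε₀/(L^k)²` versus the threshold `ε₀ (L^k)^{−2} (L^k η)^{−1} = ε₀ (L^k)^{−2}`
  have hsin : τ < 2 * |Real.sin τ| := by
    have h1 := Real.sin_gt_sub_cube hτ0
    have h3 : τ ^ 3 ≤ τ := by
      calc τ ^ 3 = τ * (τ * τ) := by ring
        _ ≤ τ * (1 * 1) := by gcongr
        _ = τ := by ring
    have h2 : 0 < Real.sin τ := by linarith
    rw [abs_of_pos h2]; linarith
  rw [hcurEq, norm_smul, norm_inv, norm_inv, Real.norm_of_nonneg hs0.le, inv_inv, norm_cexp_sub_cexp_neg, ← hsdef,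
    mul_inv_cancel₀ hs0.ne', inv_one, mul_one] at hlt
  -- `hlt : s * (2|sin τ|) < ε₀ * (s⁻¹)^2`; but `s · τ ≥ ε₀ · s⁻²` and `2|sin τ| > τ`
  have hge : ε₀ * (s⁻¹) ^ 2 ≤ s * τ := by
    have e1 : ε₀ * (s⁻¹) ^ 2 = s * (ε₀ / s ^ 3) := by field_simp
    rw [e1]
    exact mul_le_mul_of_nonneg_left hτα hs0.le
  have : s * τ < s * (2 * |Real.sin τ|) := mul_lt_mul_of_pos_left hsin hs0
  linarith

/-- **COROLLARY — `U ∉ 𝔘_k({T_η}, ε₀)`**: the same `U ∈ sfClass d L N ε′ k` is not in B8's `𝔄_k` = B11's `𝔘_k` on the torus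
(`Ω_j = T_η` for all `j`) at `η = L^{−k}`, the first factor of B11's class (6). [folklore] -/
theorem exists_mem_sfClass_not_inAk [Nonempty n] (hd : 2 ≤ d) {L : ℕ} (hL : 2 ≤ L) {N : ℕ} (hN : 1 ≤ N) {ε : ℝ}
    (hε : 0 < ε) (ε₀ : ℝ) :
    ∃ (k : ℕ) (U : B7Prop1Explicit.Site d → Fin d → (Matrix n n ℂ)ˣ),
      U ∈ sfClass (d := d) (n := n) L N ε k ∧
        ¬ InAk L k (((L : ℝ) ^ k)⁻¹) ε₀ (fun _ => (Set.univ : Set (B7Prop1Explicit.Site d))) U := by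
  obtain ⟨k, U, hU, hnot⟩ := exists_mem_sfClass_not_condAt (n := n) hd hL hN hε ε₀
  exact ⟨k, U, hU, fun h => hnot (h k le_rfl)⟩

/-- **COROLLARY — NO RADIUS WORKS**: for `d ≥ 2`, `L ≥ 2`, `N ≥ 1`, no `ε′ > 0` makes the plaquette-only ball a subset of
the level-`k` regular space for all `k` — the inclusion route `hsub` of the class-agnostic END to class (6) is closed. [folklore] -/
theorem not_sfClass_subset_condAt [Nonempty n] (hd : 2 ≤ d) {L : ℕ} (hL : 2 ≤ L) {N : ℕ} (hN : 1 ≤ N) {ε : ℝ}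
    (hε : 0 < ε) (ε₀ : ℝ) :
    ¬ ∀ k : ℕ, sfClass (d := d) (n := n) L N ε k
      ⊆ {U | CondAt L (((L : ℝ) ^ k)⁻¹) ε₀ k (Set.univ : Set (B7Prop1Explicit.Site d)) U} := by
  intro h
  obtain ⟨k, U, hU, hnot⟩ := exists_mem_sfClass_not_condAt (n := n) hd hL hN hε ε₀
  exact hnot (h k hU)

end

end Summit.QuantumFields.BalabanUV.T4Continuum.MinimalActionClassSixNeg
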